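import Summits.CriticalPhenomena.Ising3DConformalLimit.Theses.CanonicalBranchRefutation
import Summits.CriticalPhenomena.Ising3DConformalLimit.Theorems.PerfectScreeningNonSaturation
import Literature.Probability.LatticeModels.IsingExponentsProofs
import HarnessLib

/-!
# Route `CanonicalBranchRefutation`, crux `InfraredExponentZero` (stmt-CriticalPhenomena-15521):
# the crux against the neighbouring routes — `InfraredExponentZero ∨ PerfectScreening.NonSaturation`

Helper file (`--supports stmt-CriticalPhenomena-15521`) of the line lead, THEOREM-ONLY. The crux
`InfraredExponentZero := HasIsingExponentEta 3 0` (`η(3) = 0` in the logarithmic sense, the branch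
hypothesis of the negation-lens route, expected FALSE) is placed against the typed statements of the
sibling routes that its item text names as its executioners:

* `infraredExponentZero_of_hasIsingEtaBounds_zero`: the two-sided Coulomb law `HasIsingEtaBounds 3 0`
  (`c‖x‖⁻¹ ≤ ⟨σ₀σ_x⟩_{β_c} ≤ C‖x‖⁻¹`) implies the crux (tree `HasIsingExponentEta.of_bounded_holds`);
* `infraredExponentZero_of_not_nonSaturation` and **`infraredExponentZero_or_nonSaturation`**: by the
  landed `not_nonSaturation_iff_hasIsingEtaBounds_zero` (route `PerfectScreening`), saturation of the
  infrared bound along the axis gives the crux — so UNCONDITIONALLY `InfraredExponentZero ∨ NonSaturation`;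
* `nonSaturation_of_not_infraredExponentZero`: hence every refutation of this crux (kill criterion (a) of
  the route) PROVES `PerfectScreening.NonSaturation` (item stmt-CriticalPhenomena-1342) on the way;
* `not_infraredExponentZero_of_hasIsingExponentEta_pos`: any positive logarithmic exponent `η > 0`
  refutes the crux (uniqueness of the exponent along `cofinite`).

What is NOT here (and is false as an implication between the typed statements): `NonSaturation → ¬crux`.
`NonSaturation`, even upgraded to `‖x‖⟨σ₀σ_x⟩ → 0` (`ScreeningUpgrade`), is compatible with a logarithmic
exponent exactly `1` (profile `1/(‖x‖ log ‖x‖)`); refuting the log-sense crux needs a POWER gain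
(`AnomalousForcesInteraction.EtaPositive`, see `not_infraredExponentZero_of_etaPositive` in the sibling
file `…SphereMass.lean`, or `HasIsingExponentEta 3 η` with `η > 0`).

References: H. Duminil-Copin, *Lectures on the Ising and Potts models* (2019), Thm. 4.8 (infrared bound);
S. Friedli, Y. Velenik (2017), §3.10.11 (logarithmic exponents).
-/

namespace Summit.CriticalPhenomena.Ising3DConformalLimit.Theorems

open Literature.Probability.LatticeModels
open Summit.CriticalPhenomena.Ising3DConformalLimit.Theses

/-- **Coulomb ⇒ crux**: two-sided infrared-saturating bounds `c‖x‖⁻¹ ≤ ⟨σ₀σ_x⟩_{β_c(3)} ≤ C‖x‖⁻¹`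
(`HasIsingEtaBounds 3 0`) imply `η(3) = 0` in the logarithmic sense (`InfraredExponentZero`).
One line from the tree's `HasIsingExponentEta.of_bounded_holds`. [cite: FriedliVelenik2017, §3.10.11] -/
theorem infraredExponentZero_of_hasIsingEtaBounds_zero (h : HasIsingEtaBounds 3 0) :
    CanonicalBranchRefutation.InfraredExponentZero :=
  HasIsingExponentEta.of_bounded_holds h

/-- **Saturated infrared bound ⇒ crux**: if `PerfectScreening.NonSaturation` FAILS (the infrared bound
`⟨σ₀σ_{n e₁}⟩ ≤ C/n` is saturated: `liminf n⟨σ₀σ_{n e₁}⟩ > 0`), then the two-sided Coulomb law holds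
(landed `not_nonSaturation_iff_hasIsingEtaBounds_zero`, Messager–Miracle-Solé + Simon–Lieb positivity) and
hence the crux. [cite: DuminilCopin2019, Thm. 4.8, §4.4] -/
theorem infraredExponentZero_of_not_nonSaturation (h : ¬ PerfectScreening.NonSaturation) :
    CanonicalBranchRefutation.InfraredExponentZero :=
  infraredExponentZero_of_hasIsingEtaBounds_zero (not_nonSaturation_iff_hasIsingEtaBounds_zero.1 h)

/-- **Dichotomy (unconditional): `η_log(3) = 0` or the infrared bound is not saturated along the axis.**
`InfraredExponentZero ∨ PerfectScreening.NonSaturation`. [folklore] -/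
theorem infraredExponentZero_or_nonSaturation :
    Summit.CriticalPhenomena.Ising3DConformalLimit.Theses.CanonicalBranchRefutation.InfraredExponentZero ∨
      Summit.CriticalPhenomena.Ising3DConformalLimit.Theses.PerfectScreening.NonSaturation := by
  by_cases h : PerfectScreening.NonSaturation
  · exact Or.inr h
  · exact Or.inl (infraredExponentZero_of_not_nonSaturation h)

/-- **Refuting the crux pays item stmt-CriticalPhenomena-1342**: `¬ InfraredExponentZero → NonSaturation`
(contrapositive of `infraredExponentZero_of_not_nonSaturation`). So kill criterion (a) of route
`CanonicalBranchRefutation` proves `PerfectScreening.NonSaturation` on the way. [folklore] -/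
theorem nonSaturation_of_not_infraredExponentZero
    (h : ¬ CanonicalBranchRefutation.InfraredExponentZero) : PerfectScreening.NonSaturation :=
  infraredExponentZero_or_nonSaturation.resolve_left h

/-- **Any positive logarithmic exponent refutes the crux**: `HasIsingExponentEta 3 η` with `η > 0` is
incompatible with `InfraredExponentZero = HasIsingExponentEta 3 0` (the exponent along `cofinite` on the
infinite lattice is unique, `HasIsingExponentEta.unique`). [folklore] -/
theorem not_infraredExponentZero_of_hasIsingExponentEta_pos {η : ℝ} (hη : 0 < η)
    (h : HasIsingExponentEta 3 η) : ¬ CanonicalBranchRefutation.InfraredExponentZero :=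
  fun h0 => hη.ne' (h.unique (show HasIsingExponentEta 3 0 from h0))

end Summit.CriticalPhenomena.Ising3DConformalLimit.Theorems
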